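import Mathlib.Analysis.SpecialFunctions.ImproperIntegrals
import Mathlib.MeasureTheory.Integral.ExpDecay
import Mathlib.Analysis.SpecialFunctions.Pow.Asymptotics
import Mathlib.Analysis.Normed.Group.Tannery
import Mathlib.Topology.Algebra.InfiniteSum.Real
import HarnessLib

/-!
# Laplace integrability under polynomial growth, window M-test, weighted `ℓ¹` bookkeeping

Topic `Literature/Analysis/Asymptotics`; theorems only — four small tools of the Abelian (Laplace) calculus of
space–time correlation functions:

* `integrableOn_exp_neg_mul_of_abs_le_one_add_pow` — a continuous `g` with `|g t| ≤ K(1+t)^n` on `[0,∞)` is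
  Laplace-integrable on `(0,∞)` for every `ν > 0` (`e^{-νt}g = O(e^{-νt/2})`);
* `continuous_tsum_of_window_majorant` — the Weierstrass M-test on time windows: a series `Σ_x f_x(t)` of continuous
  functions with a summable majorant on every window `|t| ≤ τ` is continuous;
* `abs_le_of_weighted_tsum_le`, `summable_abs_of_weighted_summable` — from `Σ_x (1+x²)|a_x| ≤ B` to `|a_x| ≤ B` and to
  `Σ_x |a_x| < ∞`.

Everything is proved; tagged `[folklore]`.
-/

noncomputable section

open MeasureTheory Filter Set Asymptotics
open scoped Topology

namespace Literature.Analysis.Asymptotics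

/-- **Laplace integrability under polynomial growth**: if `g` is continuous and `|g t| ≤ K(1+t)^n` for `t ≥ 0`,
then `t ↦ e^{-νt} g t` is integrable on `(0, ∞)` for every `ν > 0`. [folklore] -/
theorem integrableOn_exp_neg_mul_of_abs_le_one_add_pow {g : ℝ → ℝ} (hg : Continuous g) {K : ℝ} {n : ℕ}
    (hb : ∀ t : ℝ, 0 ≤ t → |g t| ≤ K * (1 + t) ^ n) {ν : ℝ} (hν : 0 < ν) :
    IntegrableOn (fun t : ℝ => Real.exp (-(ν * t)) * g t) (Ioi 0) := by
  have hcont : ContinuousOn (fun t : ℝ => Real.exp (-(ν * t)) * g t) (Ici 0) :=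
    (Continuous.mul (by fun_prop) hg).continuousOn
  have h1 : g =O[atTop] fun t : ℝ => t ^ n := by
    refine IsBigO.of_bound (|K| * 2 ^ n) ?_
    filter_upwards [eventually_ge_atTop (1 : ℝ)] with t ht
    rw [Real.norm_eq_abs, Real.norm_eq_abs, abs_of_nonneg (pow_nonneg (by linarith : (0:ℝ) ≤ t) n)]
    have h2t : (1 + t) ^ n ≤ (2 * t) ^ n := pow_le_pow_left₀ (by linarith) (by linarith) n
    calc |g t| ≤ K * (1 + t) ^ n := hb t (by linarith)
      _ ≤ |K| * (1 + t) ^ n := mul_le_mul_of_nonneg_right (le_abs_self K) (pow_nonneg (by linarith) n)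
      _ ≤ |K| * (2 * t) ^ n := mul_le_mul_of_nonneg_left h2t (abs_nonneg K)
      _ = |K| * 2 ^ n * t ^ n := by rw [mul_pow]; ring
  have h2 : (fun t : ℝ => t ^ n) =o[atTop] fun t : ℝ => Real.exp (ν / 2 * t) :=
    isLittleO_pow_exp_pos_mul_atTop n (half_pos hν)
  have h3 : g =O[atTop] fun t : ℝ => Real.exp (ν / 2 * t) := h1.trans h2.isBigO
  have h4 : (fun t : ℝ => Real.exp (-(ν * t))) =O[atTop] fun t : ℝ => Real.exp (-(ν * t)) :=
    isBigO_refl _ _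
  have ho : (fun t : ℝ => Real.exp (-(ν * t)) * g t) =O[atTop] fun t : ℝ => Real.exp (-(ν / 2) * t) :=
    (h4.mul h3).congr_right fun t => by
      rw [← Real.exp_add]
      congr 1
      ring
  exact integrable_of_isBigO_exp_neg (half_pos hν) hcont ho

/-- **Weierstrass M-test on time windows**: a series `t ↦ Σ_x f_x(t)` of continuous functions with a summable
majorant on every window `|t| ≤ τ` is continuous. [folklore] -/
theorem continuous_tsum_of_window_majorant {ι : Type*} {f : ι → ℝ → ℝ} (hf : ∀ x, Continuous (f x))
    (hmaj : ∀ τ : ℝ, 0 ≤ τ → ∃ m : ι → ℝ, Summable m ∧ ∀ t : ℝ, |t| ≤ τ → ∀ x : ι, |f x t| ≤ m x) :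
    Continuous fun t : ℝ => ∑' x : ι, f x t := by
  refine continuous_iff_continuousAt.2 fun t₀ => ?_
  obtain ⟨m, hm, hb⟩ := hmaj (|t₀| + 1) (by positivity)
  have hon : ContinuousOn (fun t : ℝ => ∑' x : ι, f x t) (Set.Ioo (-(|t₀| + 1)) (|t₀| + 1)) :=
    continuousOn_tsum (fun x => (hf x).continuousOn) hm fun x t ht => by
      rw [Real.norm_eq_abs]; exact hb t (abs_le.2 ⟨ht.1.le, ht.2.le⟩) x
  exact hon.continuousAt (Ioo_mem_nhds (by linarith [neg_abs_le t₀]) (by linarith [le_abs_self t₀]))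

/-- From the weighted bound `Σ_x (1+x²)|a_x| ≤ B` to the bound `|a_x| ≤ B` on every term. [folklore] -/
theorem abs_le_of_weighted_tsum_le {a : ℤ → ℝ} {B : ℝ} (hs : Summable fun x : ℤ => (1 + (x : ℝ) ^ 2) * |a x|)
    (hb : (∑' x : ℤ, (1 + (x : ℝ) ^ 2) * |a x|) ≤ B) (x : ℤ) : |a x| ≤ B := by
  have h1 : |a x| ≤ (1 + (x : ℝ) ^ 2) * |a x| :=
    le_mul_of_one_le_left (abs_nonneg _) (by nlinarith [sq_nonneg (x : ℝ)])
  have h2 : (1 + (x : ℝ) ^ 2) * |a x| ≤ ∑' y : ℤ, (1 + (y : ℝ) ^ 2) * |a y| :=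
    hs.le_tsum x fun y _ => by positivity
  linarith

/-- Weighted summability `Σ_x (1+x²)|a_x| < ∞` implies `Σ_x |a_x| < ∞`. [folklore] -/
theorem summable_abs_of_weighted_summable {a : ℤ → ℝ}
    (hs : Summable fun x : ℤ => (1 + (x : ℝ) ^ 2) * |a x|) : Summable fun x : ℤ => |a x| :=
  Summable.of_nonneg_of_le (fun x => abs_nonneg _)
    (fun x => le_mul_of_one_le_left (abs_nonneg _) (by nlinarith [sq_nonneg (x : ℝ)])) hs

end Literature.Analysis.Asymptotics

end
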